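import Literature.Topology.FourManifolds.CerfPropositionFourInjective
import Literature.Topology.FourManifolds.ContMDiffNestedProd
import HarnessLib

/-!
# The frame family of a two-parameter family of diffeomorphisms of the sphere, and `π₁(SO(3)) ↪ π₁(Diff S²)`

Topic `Literature/Topology/FourManifolds`. J. Cerf, *Sur les difféomorphismes de la sphère de
dimension trois (Γ₄ = 0)*, LNM 53 (1968), Appendice §5, Proposition 4 (`π_i(Diff Sⁿ) ≈
π_i(𝒦) ⊕ π_i(SO(n+1))`) and Corollaire 2 of Théorème 4 (`π_i(SO(3)) ≅ π_i(Diff S²)`). The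
summand `π_i(SO(n+1))` is detected by the **frame map** `Diff Sⁿ → SO(n+1)` (the `1`-jet at a
point followed by Gram–Schmidt; Cerf's `Diff Sⁿ → Emb(Dⁿ, Sⁿ) ≃ SO(n+1)`, Proposition 3), a left
inverse of the inclusion. `FrameLoop.lean` constructs it along one-parameter families; this file
constructs it along **two-parameter families** (`exists_frame_family₂`), with its naturality:
the frame of the identity is `1` and the frame of a linear isometry `A|𝕊ⁿ` is `A` itself.
Consequence (`exists_isometry_nullhomotopy_of_diffeo_nullhomotopy`): **a smooth based loop of
linear isometries of `ℝⁿ⁺¹` which is null-homotopic through smooth based loops of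
diffeomorphisms of `𝕊ⁿ` is null-homotopic through smooth based loops of linear isometries** —
the injectivity of `π₁(SO(n+1)) → π₁(Diff Sⁿ)` (all `n`), which together with
`exists_loopHomotopy_frameLoop_two` (`SphereDiffeoLoops.lean`, surjectivity for `n = 2`) is
Corollaire 2 at `i = 1`.

Everything here is proved; there are no definitions and no named facts.

## References

* J. Cerf, *Sur les difféomorphismes de la sphère de dimension trois (Γ₄ = 0)*, Lecture Notes in
  Mathematics 53, Springer (1968), Appendice §5, Propositions 3–4, Théorème 4, Corollaire 2.
  [CerfDiffeoSphere1968]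
-/

open scoped Manifold ContDiff Topology RealInnerProductSpace
open Function Set Filter Metric Module InnerProductSpace

noncomputable section

namespace Literature.Topology.FourManifolds

/-- Local notation: `𝔼 n` is the model Euclidean space `EuclideanSpace ℝ (Fin n)`. -/
local notation "𝔼 " n:arg => EuclideanSpace ℝ (Fin n)

/-- Local notation: `𝕊 n` is the unit sphere in `EuclideanSpace ℝ (Fin (n + 1))`. -/
local notation "𝕊 " n:arg => (Metric.sphere (0 : EuclideanSpace ℝ (Fin (n + 1))) 1)

attribute [local instance] fact_finrank_euclideanSpace_succ

variable {n : ℕ}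

/-- **Joint smoothness of the homogeneous extension of a two-parameter family of sphere maps,
off the origin** (the two-parameter form of `contDiffAt_homExt_family`). [folklore] -/
theorem contDiffAt_homExt_family₂ (v : 𝕊 n) {F : ℝ × ℝ → (𝕊 n) → 𝕊 n}
    (hF : ContMDiff (𝓘(ℝ, ℝ).prod (𝓘(ℝ, ℝ).prod (𝓡 n))) (𝓡 n) ∞
      fun p : ℝ × (ℝ × 𝕊 n) => F (p.1, p.2.1) p.2.2)
    {w : ℝ × ℝ} {x : 𝔼 (n + 1)} (hx : x ≠ 0) :
    ContDiffAt ℝ ∞ (uncurry fun (w : ℝ × ℝ) (x : 𝔼 (n + 1)) =>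
      ‖x‖ • ((F w (radialProjection v x) : 𝕊 n) : 𝔼 (n + 1))) (w, x) := by
  -- as a map on `ℝ × (ℝ × ℝⁿ⁺¹)`
  have h1 : ContMDiffAt (𝓘(ℝ, ℝ).prod (𝓘(ℝ, ℝ).prod 𝓘(ℝ, 𝔼 (n + 1)))) (𝓘(ℝ, ℝ).prod (𝓘(ℝ, ℝ).prod (𝓡 n))) ∞
      (fun q : ℝ × (ℝ × 𝔼 (n + 1)) => ((q.1, (q.2.1, radialProjection v q.2.2)) : ℝ × (ℝ × 𝕊 n)))
      (w.1, (w.2, x)) :=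
    contMDiffAt_fst.prodMk ((contMDiffAt_fst.comp _ contMDiffAt_snd).prodMk
      ((contMDiffAt_radialProjection v hx).comp (w.1, (w.2, x)) (contMDiffAt_snd.comp _ contMDiffAt_snd)))
  have h2 : ContMDiffAt (𝓘(ℝ, ℝ).prod (𝓘(ℝ, ℝ).prod 𝓘(ℝ, 𝔼 (n + 1)))) 𝓘(ℝ, 𝔼 (n + 1)) ∞
      (fun q : ℝ × (ℝ × 𝔼 (n + 1)) => ((F (q.1, q.2.1) (radialProjection v q.2.2) : 𝕊 n) : 𝔼 (n + 1)))
      (w.1, (w.2, x)) :=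
    (contMDiff_coe_sphere.comp hF).contMDiffAt.comp (w.1, (w.2, x)) h1
  have h3 : ContDiffAt ℝ ∞
      (fun q : ℝ × (ℝ × 𝔼 (n + 1)) => ((F (q.1, q.2.1) (radialProjection v q.2.2) : 𝕊 n) : 𝔼 (n + 1)))
      (w.1, (w.2, x)) := contDiffAt_of_contMDiffAt_nested h2
  -- back to `(ℝ × ℝ) × ℝⁿ⁺¹`
  have h4 : ContDiffAt ℝ ∞
      (fun q : (ℝ × ℝ) × 𝔼 (n + 1) => ((F q.1 (radialProjection v q.2) : 𝕊 n) : 𝔼 (n + 1))) (w, x) := by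
    have e : (fun q : (ℝ × ℝ) × 𝔼 (n + 1) => ((F q.1 (radialProjection v q.2) : 𝕊 n) : 𝔼 (n + 1))) =
        (fun q : ℝ × (ℝ × 𝔼 (n + 1)) => ((F (q.1, q.2.1) (radialProjection v q.2.2) : 𝕊 n) : 𝔼 (n + 1))) ∘
          fun q : (ℝ × ℝ) × 𝔼 (n + 1) => (q.1.1, (q.1.2, q.2)) := by
      funext q; rfl
    rw [e]
    exact h3.comp (w, x) ((contDiffAt_fst.fst).prodMk (contDiffAt_fst.snd.prodMk contDiffAt_snd))
  have h5 : ContDiffAt ℝ ∞ (fun q : (ℝ × ℝ) × 𝔼 (n + 1) => ‖q.2‖) (w, x) :=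
    (contDiffAt_snd (p := (w, x))).norm ℝ hx
  exact h5.smul h4

/-- The homogeneous extension of a linear isometry restricted to the sphere is the isometry, off
the origin. [folklore] -/
theorem homExt_sphereCongr {v : 𝕊 n} (A : 𝔼 (n + 1) ≃ₗᵢ[ℝ] 𝔼 (n + 1)) {x : 𝔼 (n + 1)} (hx : x ≠ 0) :
    ‖x‖ • ((sphereCongr A (radialProjection v x) : 𝕊 n) : 𝔼 (n + 1)) = A x := by
  rw [coe_sphereCongr, coe_radialProjection_of_ne_zero v hx, map_smul,
    smul_inv_smul₀ (norm_ne_zero_iff.mpr hx)]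

/-- **The frame family of a two-parameter family of diffeomorphisms of `𝕊ⁿ`** (Cerf 1968,
Appendice §5, the map `Diff Sⁿ → SO(n+1)` of Propositions 3–4, along families). Let `𝒟_w`
(`w ∈ ℝ²`) be a jointly smooth family of diffeomorphisms of `𝕊ⁿ` with jointly smooth inverses
and `v ∈ 𝕊ⁿ`. There is a family `𝒜_w` of linear isometries of `ℝⁿ⁺¹`, smooth in `w`, with
`𝒜_w v = 𝒟_w v`, **equal to `1` wherever `𝒟_w` is the identity near `v`, and equal to `A`
wherever `𝒟_w = A|𝕊ⁿ` for a linear isometry `A`**. (`𝒜_w` takes an orthonormal basis `b` with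
`b 0 = v` to the Gram–Schmidt orthonormalisation of its image under the differential at `v` of
the homogeneous extension of `𝒟_w`.) [cite: CerfDiffeoSphere1968, Appendice §5, Prop. 3 and Prop. 4] -/
theorem exists_frame_family₂ (𝒟 𝒟inv : ℝ × ℝ → (𝕊 n) → 𝕊 n)
    (h𝒟 : ContMDiff (𝓘(ℝ, ℝ).prod (𝓘(ℝ, ℝ).prod (𝓡 n))) (𝓡 n) ∞
      fun p : ℝ × (ℝ × 𝕊 n) => 𝒟 (p.1, p.2.1) p.2.2)
    (h𝒟inv : ∀ w, ContMDiff (𝓡 n) (𝓡 n) ∞ (𝒟inv w)) (hinv : ∀ w x, 𝒟inv w (𝒟 w x) = x)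
    (v : 𝕊 n) :
    ∃ 𝒜 : ℝ × ℝ → (𝔼 (n + 1) ≃ₗᵢ[ℝ] 𝔼 (n + 1)),
      ContDiff ℝ ∞ (fun w => (𝒜 w : 𝔼 (n + 1) →L[ℝ] 𝔼 (n + 1))) ∧
      (∀ w, 𝒜 w v = 𝒟 w v) ∧
      (∀ w, (∀ᶠ z in 𝓝 v, 𝒟 w z = z) → 𝒜 w = LinearIsometryEquiv.refl ℝ (𝔼 (n + 1))) ∧
      (∀ w (A : 𝔼 (n + 1) ≃ₗᵢ[ℝ] 𝔼 (n + 1)), (∀ z, 𝒟 w z = sphereCongr A z) → 𝒜 w = A) := by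
  have hv0 : (v : 𝔼 (n + 1)) ≠ 0 := ne_zero_of_mem_unit_sphere v
  have hv1 : ‖(v : 𝔼 (n + 1))‖ = 1 := norm_eq_of_mem_sphere v
  have h𝒟w : ∀ w, ContMDiff (𝓡 n) (𝓡 n) ∞ (𝒟 w) := fun w =>
    h𝒟.comp (contMDiff_const.prodMk (contMDiff_const.prodMk contMDiff_id))
  -- the homogeneous extensions and the `1`-jets `M w = D(Fh w)(v)`
  set Fh : ℝ × ℝ → 𝔼 (n + 1) → 𝔼 (n + 1) := fun w x =>
    ‖x‖ • ((𝒟 w (radialProjection v x) : 𝕊 n) : 𝔼 (n + 1)) with hFh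
  have hFh_at : ∀ w, ∀ x : 𝔼 (n + 1), x ≠ 0 → ContDiffAt ℝ ∞ (uncurry Fh) (w, x) :=
    fun w x hx => contDiffAt_homExt_family₂ v h𝒟 hx
  have hFh_slice : ∀ w, ∀ x : 𝔼 (n + 1), x ≠ 0 → ContDiffAt ℝ ∞ (Fh w) x := fun w x hx =>
    (hFh_at w x hx).comp x (contDiffAt_const.prodMk contDiffAt_id)
  set M : ℝ × ℝ → 𝔼 (n + 1) →L[ℝ] 𝔼 (n + 1) := fun w => fderiv ℝ (Fh w) (v : 𝔼 (n + 1)) with hM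
  have hM_smooth : ContDiff ℝ ∞ M := by
    rw [contDiff_iff_contDiffAt]
    intro w
    exact (hFh_at w _ hv0).fderiv (contDiffAt_const (c := (v : 𝔼 (n + 1)))) (by simp)
  have hM_deriv : ∀ w, HasFDerivAt (Fh w) (M w) (v : 𝔼 (n + 1)) := fun w =>
    ((hFh_slice w _ hv0).differentiableAt (by simp)).hasFDerivAt
  have hM_id : ∀ w, (∀ᶠ z in 𝓝 v, 𝒟 w z = z) → M w = 1 := by
    intro w hw
    show fderiv ℝ (Fh w) (v : 𝔼 (n + 1)) = 1
    rw [(homExt_eventuallyEq_id v hw).fderiv_eq, fderiv_id]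
    rfl
  have hM_iso : ∀ w (A : 𝔼 (n + 1) ≃ₗᵢ[ℝ] 𝔼 (n + 1)), (∀ z, 𝒟 w z = sphereCongr A z) →
      M w = (A : 𝔼 (n + 1) →L[ℝ] 𝔼 (n + 1)) := by
    intro w A hA
    show fderiv ℝ (Fh w) (v : 𝔼 (n + 1)) = (A : 𝔼 (n + 1) →L[ℝ] 𝔼 (n + 1))
    have hev : Fh w =ᶠ[𝓝 (v : 𝔼 (n + 1))] fun x => A x := by
      filter_upwards [isOpen_ne.mem_nhds hv0] with x hx
      show ‖x‖ • ((𝒟 w (radialProjection v x) : 𝕊 n) : 𝔼 (n + 1)) = A x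
      rw [hA, homExt_sphereCongr A hx]
    rw [hev.fderiv_eq]
    exact (A : 𝔼 (n + 1) →L[ℝ] 𝔼 (n + 1)).fderiv
  have hMv : ∀ w, M w (v : 𝔼 (n + 1)) = 𝒟 w v := fun w =>
    homExt_fderiv_apply_self v (𝒟 w) (hM_deriv w)
  have hMinj : ∀ w, Injective (M w) := by
    intro w
    have hGd : ContDiffAt ℝ ∞ (fun x : 𝔼 (n + 1) =>
        ‖x‖ • ((𝒟inv w (radialProjection v x) : 𝕊 n) : 𝔼 (n + 1)))
        ((𝒟 w v : 𝕊 n) : 𝔼 (n + 1)) :=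
      contDiffAt_homExt v (h𝒟inv w) (ne_zero_of_mem_unit_sphere _)
    have h1 := homExt_fderiv_leftInverse v (f := 𝒟 w) (g := 𝒟inv w)
      (hinv w) (hM_deriv w) ((hGd.differentiableAt (by simp)).hasFDerivAt)
    intro a b hab
    have := congrArg (fderiv ℝ (fun x : 𝔼 (n + 1) =>
      ‖x‖ • ((𝒟inv w (radialProjection v x) : 𝕊 n) : 𝔼 (n + 1)))
      ((𝒟 w v : 𝕊 n) : 𝔼 (n + 1))) hab
    rwa [← ContinuousLinearMap.comp_apply, ← ContinuousLinearMap.comp_apply, h1,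
      one_apply_eq_self, one_apply_eq_self] at this
  -- an orthonormal basis with `b 0 = v`, its images, and their Gram–Schmidt orthonormalisation
  obtain ⟨b, hb0⟩ := exists_orthonormalBasis_zero_eq v
  set u : ℝ × ℝ → Fin (n + 1) → 𝔼 (n + 1) := fun w i => M w (b i) with hu
  have hu_li : ∀ w, LinearIndependent ℝ (u w) := fun w =>
    b.toBasis.linearIndependent.map' (M w : 𝔼 (n + 1) →ₗ[ℝ] 𝔼 (n + 1))
      (LinearMap.ker_eq_bot.mpr (by exact hMinj w))
  have hu_smooth : ∀ i, ContDiff ℝ ∞ fun w => u w i := fun i =>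
    hM_smooth.clm_apply contDiff_const
  set gsn : ℝ × ℝ → Fin (n + 1) → 𝔼 (n + 1) := fun w i => gramSchmidtNormed ℝ (u w) i with hgsn
  have hgsn_smooth : ∀ i, ContDiff ℝ ∞ fun w => gsn w i := fun i =>
    contDiff_gramSchmidtNormed hu_smooth hu_li i
  have hgsn_ne : ∀ w i, gsn w i ≠ 0 := fun w i => by
    rw [← norm_ne_zero_iff, gramSchmidtNormed_unit_length i (hu_li w)]; exact one_ne_zero
  -- Gram–Schmidt of an orthonormal family is the family: the case `M w = A`
  have hgsn_iso : ∀ w (A : 𝔼 (n + 1) ≃ₗᵢ[ℝ] 𝔼 (n + 1)), M w = (A : 𝔼 (n + 1) →L[ℝ] 𝔼 (n + 1)) →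
      gsn w = fun i => A (b i) := by
    intro w A hw
    have hu' : u w = fun i => A (b i) := by
      funext i; simp only [hu, hw]; rfl
    have hon : Orthonormal ℝ fun i => A (b i) := b.orthonormal.comp_linearIsometry A.toLinearIsometry
    funext i
    simp only [hgsn, hu']
    rw [gramSchmidtNormed, gramSchmidt_of_orthogonal ℝ hon.2, hon.1 i]
    simp
  -- the orthonormal bases and the isometries `𝒜 w : b ↦ gsn w`
  have hcard : finrank ℝ (𝔼 (n + 1)) = Fintype.card (Fin (n + 1)) := by
    rw [finrank_euclideanSpace_fin, Fintype.card_fin]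
  set c : ℝ × ℝ → OrthonormalBasis (Fin (n + 1)) ℝ (𝔼 (n + 1)) := fun w =>
    gramSchmidtOrthonormalBasis hcard (u w) with hc
  have hc_apply : ∀ w i, c w i = gsn w i := fun w i =>
    gramSchmidtOrthonormalBasis_apply hcard (hgsn_ne w i)
  set 𝒜 : ℝ × ℝ → (𝔼 (n + 1) ≃ₗᵢ[ℝ] 𝔼 (n + 1)) := fun w => b.equiv (c w) (Equiv.refl _) with h𝒜
  have h𝒜_b : ∀ w i, 𝒜 w (b i) = gsn w i := fun w i => by
    rw [h𝒜]
    show (b.equiv (c w) (Equiv.refl _)) (b i) = gsn w i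
    rw [OrthonormalBasis.equiv_apply_basis, Equiv.refl_apply, hc_apply]
  have h𝒜_sum : ∀ w, (𝒜 w : 𝔼 (n + 1) →L[ℝ] 𝔼 (n + 1)) = ∑ i,
      ContinuousLinearMap.smulRightL ℝ (𝔼 (n + 1)) (𝔼 (n + 1)) (innerSL ℝ (b i)) (gsn w i) := by
    intro w
    refine ContinuousLinearMap.ext fun x => ?_
    rw [FunLike.coe_sum, Finset.sum_apply]
    simp only [ContinuousLinearMap.smulRightL_apply_apply]
    show 𝒜 w x = ∑ i, ⟪b i, x⟫ • gsn w i
    rw [h𝒜]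
    show (b.equiv (c w) (Equiv.refl _)) x = _
    rw [OrthonormalBasis.equiv_apply]
    simp only [Equiv.refl_apply, OrthonormalBasis.repr_apply_apply, hc_apply]
  have h𝒜_smooth : ContDiff ℝ ∞ fun w => (𝒜 w : 𝔼 (n + 1) →L[ℝ] 𝔼 (n + 1)) := by
    have : (fun w => (𝒜 w : 𝔼 (n + 1) →L[ℝ] 𝔼 (n + 1))) = fun w => ∑ i,
        ContinuousLinearMap.smulRightL ℝ (𝔼 (n + 1)) (𝔼 (n + 1)) (innerSL ℝ (b i)) (gsn w i) :=
      funext h𝒜_sum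
    rw [this]
    exact ContDiff.sum fun i _ =>
      (ContinuousLinearMap.smulRightL ℝ (𝔼 (n + 1)) (𝔼 (n + 1)) (innerSL ℝ (b i))).contDiff.comp
        (hgsn_smooth i)
  -- naturality at isometries (and at the identity)
  have h𝒜_iso : ∀ w (A : 𝔼 (n + 1) ≃ₗᵢ[ℝ] 𝔼 (n + 1)), M w = (A : 𝔼 (n + 1) →L[ℝ] 𝔼 (n + 1)) → 𝒜 w = A := by
    intro w A hw
    apply b.toBasis.ext_linearIsometryEquiv
    intro i
    rw [OrthonormalBasis.coe_toBasis, h𝒜_b, hgsn_iso w A hw]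
  -- `𝒜 w v = 𝒟 w v`
  have h𝒜v : ∀ w, 𝒜 w v = 𝒟 w v := by
    intro w
    rw [← hb0, h𝒜_b]
    simp only [hgsn, gramSchmidtNormed]
    have h0 : gramSchmidt ℝ (u w) 0 = M w (b 0) := by
      rw [← bot_eq_zero, gramSchmidt_bot]
    have h1 : M w (b 0) = 𝒟 w v := by rw [hb0, hMv]
    rw [h0, h1, norm_eq_of_mem_sphere, RCLike.ofReal_real_eq_id, id_eq, inv_one, one_smul]
  refine ⟨𝒜, h𝒜_smooth, h𝒜v, fun w hw => ?_, fun w A hA => h𝒜_iso w A (hM_iso w A hA)⟩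
  have h1 : M w = ((LinearIsometryEquiv.refl ℝ (𝔼 (n + 1)) : 𝔼 (n + 1) ≃ₗᵢ[ℝ] 𝔼 (n + 1)) :
      𝔼 (n + 1) →L[ℝ] 𝔼 (n + 1)) := by
    rw [hM_id w hw]; rfl
  exact h𝒜_iso w _ h1

/-- **`π₁(SO(n+1)) → π₁(Diff Sⁿ)` is injective, smooth families form** (Cerf 1968, Appendice §5,
Proposition 4 at `i = 1`, the `SO(n+1)`-summand; for `n = 2` with
`exists_loopHomotopy_frameLoop_two` this is Corollaire 2 at `i = 1`). Let `A_t` be a smooth loop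
of linear isometries of `ℝⁿ⁺¹` and `𝒟_{σ,t}` a jointly smooth two-parameter family of
diffeomorphisms of `𝕊ⁿ` (with smooth inverses) which is a null-homotopy of the loop `A|𝕊ⁿ`
through based loops: `𝒟_{1,t} = A_t|𝕊ⁿ`, `𝒟_{0,t} = id`, and `𝒟_{σ,t} = id` for `t ∉ (0, 1)`.
Then `A` is null-homotopic through smooth based loops of linear isometries: the frame family
`𝒜_{σ,t}` of `𝒟` at any point `v` has `𝒜_{1,t} = A_t`, `𝒜_{0,t} = 1` and `𝒜_{σ,t} = 1` for
`t ∉ (0, 1)`. [cite: CerfDiffeoSphere1968, Appendice §5, Prop. 4 and Théorème 4, Corollaire 2] -/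
theorem exists_isometry_nullhomotopy_of_diffeo_nullhomotopy (A : ℝ → (𝔼 (n + 1) ≃ₗᵢ[ℝ] 𝔼 (n + 1)))
    (𝒟 𝒟inv : ℝ → ℝ → (𝕊 n) → 𝕊 n)
    (h𝒟 : ContMDiff (𝓘(ℝ, ℝ).prod (𝓘(ℝ, ℝ).prod (𝓡 n))) (𝓡 n) ∞
      fun p : ℝ × (ℝ × 𝕊 n) => 𝒟 p.1 p.2.1 p.2.2)
    (h𝒟inv : ContMDiff (𝓘(ℝ, ℝ).prod (𝓘(ℝ, ℝ).prod (𝓡 n))) (𝓡 n) ∞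
      fun p : ℝ × (ℝ × 𝕊 n) => 𝒟inv p.1 p.2.1 p.2.2)
    (hinv : ∀ σ t x, 𝒟inv σ t (𝒟 σ t x) = x)
    (h1 : ∀ t x, 𝒟 1 t x = sphereCongr (A t) x) (h0 : ∀ t x, 𝒟 0 t x = x)
    (hends : ∀ σ t, t ≤ 0 ∨ 1 ≤ t → ∀ x, 𝒟 σ t x = x) (v : 𝕊 n) :
    ∃ 𝒜 : ℝ → ℝ → (𝔼 (n + 1) ≃ₗᵢ[ℝ] 𝔼 (n + 1)),
      ContDiff ℝ ∞ (fun w : ℝ × ℝ => (𝒜 w.1 w.2 : 𝔼 (n + 1) →L[ℝ] 𝔼 (n + 1))) ∧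
      (∀ t, 𝒜 1 t = A t) ∧ (∀ t, 𝒜 0 t = LinearIsometryEquiv.refl ℝ (𝔼 (n + 1))) ∧
      (∀ σ t, t ≤ 0 ∨ 1 ≤ t → 𝒜 σ t = LinearIsometryEquiv.refl ℝ (𝔼 (n + 1))) := by
  have h𝒟inv_w : ∀ w : ℝ × ℝ, ContMDiff (𝓡 n) (𝓡 n) ∞ (𝒟inv w.1 w.2) := fun w =>
    h𝒟inv.comp (contMDiff_const.prodMk (contMDiff_const.prodMk contMDiff_id))
  obtain ⟨𝒜, h𝒜s, -, h𝒜id, h𝒜iso⟩ := exists_frame_family₂ (fun w => 𝒟 w.1 w.2) (fun w => 𝒟inv w.1 w.2)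
    h𝒟 h𝒟inv_w (fun w x => hinv w.1 w.2 x) v
  refine ⟨fun σ t => 𝒜 (σ, t), h𝒜s, fun t => h𝒜iso (1, t) (A t) (h1 t), fun t => ?_, fun σ t ht => ?_⟩
  · exact h𝒜id (0, t) (Eventually.of_forall fun z => h0 t z)
  · exact h𝒜id (σ, t) (Eventually.of_forall fun z => hends σ t ht z)

end Literature.Topology.FourManifolds
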